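import Literature.AnabelianGeometry.SemiGraphs.TemperedPiRayApartment
import Mathlib.Data.ZMod.QuotientGroup
import HarnessLib

/-!
# Level-wise finiteness and far fixed vertices of the apartment generators ([SemiAnbd] Thm 3.7 (i)/(iii), pp. 40–41)

Mochizuki, *Semi-graphs of anabelioids*, Publ. RIMS **42** (2006) [MochizukiSemiAnbd2006], §3: Prop. 3.6
p. 38 (`π₁^temp(𝒢) := lim_i Gal(𝒢_{∞,i}/𝒢)`), Thm. 3.7 (i) p. 40 ("the verticial subgroups … [necessarily
compact!]") and the proof of Thm. 3.7 (iii) p. 41. [cite: MochizukiSemiAnbd2006, Thm 3.7(iii) pp.40-41]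

PROOF-ONLY file (abc-iut cell, FRONTIER programme REFUTE-F1732, brick R6, tree side; seat abc-iut-w5-d160
gen 5; no definitions, no named facts).  Two of the four LEVEL-WISE binders of abc-iut-L3-d4's escape
assembly `thetaRay_not_compactInVerticialAt_of_levelEscape` (`ThetaRayEscape.lean`), produced GENERICALLY
— for any countable `𝒢`, any Galois tower `D : GaloisLevelData 𝒢` (abc-iut-L3-t9), any compatible point /
edge-point sequence (abc-iut-L3-t6) and any ray of closed edges with its apartment (abc-iut-L3-t11's
`rayPointSeq` / `rayEdgeSeq`, `TemperedPiRayApartment.lean`):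

* (hfin) `PointSeq.isOfFinOrder_gal` — every level component `σ_n^h = ρ_n (ψ(h))` of a decomposition
  homomorphism `ψ = P.decompHom : Π_w → π₁^temp` has FINITE ORDER: `h ↦ σ_n^h` is a continuous homomorphism
  of the compact group `Π_w` into the discrete group `Gal(𝒢_{∞,n}/𝒢)`, so its image is finite
  (`PointSeq.finite_range_gal`); edge form `EdgeSeq.isOfFinOrder_galE`; apartment form
  `isOfFinOrder_proj_rayGen` for the edge generators `z_k(x) := ψ_{k+1}((βp k)_* x)` — d4's binder `hfin`;
* (hfar) `exists_fixed_over_succ_rayGen` / `exists_fixed_over_rayGen` — `z_k(x)` fixes, at every level, a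
  tree vertex over `v (k+1)` and one over `v k` (the apartment vertices; abc-iut-L3-t11's
  `treeAct_rayGen_vertexMap(_succ)` + `treeProj_vertexMap_rayVertex`) — at the ray `𝒢_θ` (`v = id`) this is
  d4's binder `hfar` («a fixed vertex over a position `≥ k`»).

Consumer: the R7 assembly at the desk countermodel `𝒢_θ` of abc-iut-L3-d1 (memo
HOME/staging/L3/L3-d1/g3/COUNTERMODEL-Thm37iii-infinite.md) — towards a kernel erratum for the ∀-countable
reading of [SemiAnbd] Thm 3.7 (iii) ([IUTchI] Rmk 2.5.3); print proves finite `𝔾` (kernel: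
`compactInVerticialAt_of_finiteGraph`).  Nothing here bears on [IUTchIII] Cor. 3.12; typed ≠ proved.
-/

namespace Literature.AnabelianGeometry.SemiGraphs

namespace ProfiniteSemiGraph

namespace GaloisLevelData

open CategoryTheory Topology

universe u

variable {𝒢 : ProfiniteSemiGraph.{u}} {D : GaloisLevelData 𝒢} {h𝒢 : 𝒢.IsCountable}

/-! ### (hfin) the level components of a decomposition homomorphism have finite order -/

namespace PointSeq

variable {w : 𝒢.graph.Vertex} (P : D.PointSeq h𝒢 w)

/-- **The level-`n` image of `Π_w` under `h ↦ σ_n^h` is finite**: a continuous homomorphism of the compact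
group `Π_w` into the discrete group `Gal(𝒢_{∞,n}/𝒢)` has compact, hence finite, image.
[cite: MochizukiSemiAnbd2006, Thm 3.7(i) p.40] -/
theorem finite_range_gal (n : ℕ) : (Set.range fun h : 𝒢.Gv w => P.gal n h).Finite := by
  have hcont : Continuous fun h : 𝒢.Gv w => P.gal n h :=
    (D.continuous_proj h𝒢 n).comp P.continuous_decompHom
  exact (isCompact_range hcont).finite_of_discrete

/-- **(hfin) Every level component `σ_n^h` of a decomposition homomorphism has finite order.**
[cite: MochizukiSemiAnbd2006, Thm 3.7(i) p.40] -/
theorem isOfFinOrder_gal (n : ℕ) (h : 𝒢.Gv w) : IsOfFinOrder (P.gal n h) := by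
  rw [← finite_zpowers]
  refine (P.finite_range_gal n).subset ?_
  rintro _ ⟨m, rfl⟩
  refine ⟨h ^ m, ?_⟩
  change ((D.proj h𝒢 n).comp P.decompHom) (h ^ m) = (((D.proj h𝒢 n).comp P.decompHom) h) ^ m
  exact map_zpow _ h m

/-- (hfin), `proj ∘ decompHom` form: `ρ_n (ψ(h))` has finite order. [cite: MochizukiSemiAnbd2006, Thm 3.7(i) p.40] -/
theorem isOfFinOrder_proj_decompHom (n : ℕ) (h : 𝒢.Gv w) :
    IsOfFinOrder (D.proj h𝒢 n (P.decompHom h)) :=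
  P.isOfFinOrder_gal n h

end PointSeq

namespace EdgeSeq

variable {e : 𝒢.graph.Edge} (Q : D.EdgeSeq h𝒢 e) (hc : 𝒢.graph.IsConnected)

/-- The level-`n` image of `Π_e` under `h ↦ σ_n^h` (edge decomposition homomorphism) is finite.
[cite: MochizukiSemiAnbd2006, Thm 3.7(iii) p.41] -/
theorem finite_range_galE (n : ℕ) : (Set.range fun h : 𝒢.Ge e => Q.galE hc n h).Finite := by
  have hcont : Continuous fun h : 𝒢.Ge e => Q.galE hc n h :=
    (D.continuous_proj h𝒢 n).comp (Q.continuous_decompHomE hc)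
  exact (isCompact_range hcont).finite_of_discrete

/-- (hfin), edge form: every level component of an edge decomposition homomorphism has finite order.
[cite: MochizukiSemiAnbd2006, Thm 3.7(iii) p.41] -/
theorem isOfFinOrder_galE (n : ℕ) (h : 𝒢.Ge e) : IsOfFinOrder (Q.galE hc n h) := by
  rw [← finite_zpowers]
  refine (Q.finite_range_galE hc n).subset ?_
  rintro _ ⟨m, rfl⟩
  refine ⟨h ^ m, ?_⟩
  change ((D.proj h𝒢 n).comp (Q.decompHomE hc)) (h ^ m) = (((D.proj h𝒢 n).comp (Q.decompHomE hc)) h) ^ m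
  exact map_zpow _ h m

/-- (hfin), `proj ∘ decompHomE` form. [cite: MochizukiSemiAnbd2006, Thm 3.7(iii) p.41] -/
theorem isOfFinOrder_proj_decompHomE (n : ℕ) (h : 𝒢.Ge e) :
    IsOfFinOrder (D.proj h𝒢 n (Q.decompHomE hc h)) :=
  Q.isOfFinOrder_galE hc n h

end EdgeSeq

/-! ### The apartment generators: (hfin) and (hfar) -/

section Ray

variable {v : ℕ → 𝒢.graph.Vertex} {βm βp : ℕ → 𝒢.graph.Branch}
  (ham : ∀ k, 𝒢.graph.abuts (βm k) = some (v k))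
  (hap : ∀ k, 𝒢.graph.abuts (βp k) = some (v (k + 1)))
  (hmp : ∀ k, 𝒢.graph.edgeOf (βp k) = 𝒢.graph.edgeOf (βm k))
  (P₀ : D.PointSeq h𝒢 (v 0))

/-- **(hfin) for the apartment generators**: every level component of
`z_k(x) := ψ_{k+1}((βp k)_* x)` has finite order. [cite: MochizukiSemiAnbd2006, Thm 3.7(iii) p.41] -/
theorem isOfFinOrder_proj_rayGen (k j : ℕ) (x : 𝒢.Ge (𝒢.graph.edgeOf (βp k))) :
    IsOfFinOrder (D.proj h𝒢 j ((rayPointSeq ham hap hmp P₀ (k + 1)).decompHom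
      (𝒢.brHom (βp k) (v (k + 1)) (hap k) x))) :=
  (rayPointSeq ham hap hmp P₀ (k + 1)).isOfFinOrder_proj_decompHom j _

/-- (hfin) for the images of the vertex groups along the apartment: every level component of `ψ_k(h)`,
`h ∈ Π_{v k}`, has finite order. [cite: MochizukiSemiAnbd2006, Thm 3.7(i) p.40] -/
theorem isOfFinOrder_proj_rayDecompHom (k j : ℕ) (h : 𝒢.Gv (v k)) :
    IsOfFinOrder (D.proj h𝒢 j ((rayPointSeq ham hap hmp P₀ k).decompHom h)) :=
  (rayPointSeq ham hap hmp P₀ k).isOfFinOrder_proj_decompHom j h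

/-- **(hfar) for the apartment generators, upper vertex**: at every level `j`, `z_k(x)` fixes a tree vertex
lying over `v (k+1)` — the `(k+1)`-st apartment vertex. [cite: MochizukiSemiAnbd2006, Thm 3.7(iii) p.41] -/
theorem exists_fixed_over_succ_rayGen (k j : ℕ) (x : 𝒢.Ge (𝒢.graph.edgeOf (βp k))) :
    ∃ y : (D.tree j).Vertex, (D.treeProj j).vertexMap y = v (k + 1) ∧
      (D.treeAct h𝒢 j ((rayPointSeq ham hap hmp P₀ (k + 1)).decompHom
        (𝒢.brHom (βp k) (v (k + 1)) (hap k) x))).hom.vertexMap y = y :=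
  ⟨(rayPointSeq ham hap hmp P₀ (k + 1)).vertex j, treeProj_vertexMap_rayVertex ham hap hmp P₀ (k + 1) j,
    treeAct_rayGen_vertexMap_succ ham hap hmp P₀ k j x⟩

/-- **(hfar), lower vertex**: at every level `j`, `z_k(x)` also fixes a tree vertex lying over `v k` — the
`k`-th apartment vertex (by the alignment `ψ_{k+1} ∘ (βp k)_* = ψ_k ∘ (βm k)_*`; needs `𝔾` connected for the
edge decomposition homomorphisms). [cite: MochizukiSemiAnbd2006, Thm 3.7(iii) p.41] -/
theorem exists_fixed_over_rayGen (hc : 𝒢.graph.IsConnected) (k j : ℕ) (x : 𝒢.Ge (𝒢.graph.edgeOf (βp k))) :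
    ∃ y : (D.tree j).Vertex, (D.treeProj j).vertexMap y = v k ∧
      (D.treeAct h𝒢 j ((rayPointSeq ham hap hmp P₀ (k + 1)).decompHom
        (𝒢.brHom (βp k) (v (k + 1)) (hap k) x))).hom.vertexMap y = y :=
  ⟨(rayPointSeq ham hap hmp P₀ k).vertex j, treeProj_vertexMap_rayVertex ham hap hmp P₀ k j,
    treeAct_rayGen_vertexMap hc ham hap hmp P₀ k j x⟩

/-- (hfar) for the vertex groups along the apartment: `ψ_k(h)` fixes at every level a tree vertex over
`v k`. [cite: MochizukiSemiAnbd2006, Thm 3.7(i) p.40] -/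
theorem exists_fixed_over_rayDecompHom (k j : ℕ) (h : 𝒢.Gv (v k)) :
    ∃ y : (D.tree j).Vertex, (D.treeProj j).vertexMap y = v k ∧
      (D.treeAct h𝒢 j ((rayPointSeq ham hap hmp P₀ k).decompHom h)).hom.vertexMap y = y :=
  ⟨(rayPointSeq ham hap hmp P₀ k).vertex j, treeProj_vertexMap_rayVertex ham hap hmp P₀ k j,
    treeAct_rayDecompHom_vertexMap ham hap hmp P₀ k j h⟩

/-- **(hfar) in the height form of the escape assembly**: for a height `H` on the base vertices with
`k ≤ H (v (k+1))` (e.g. the position on a ray, `H = id`), `z_k(x)` fixes at every level a tree vertex of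
height `≥ k`. [cite: MochizukiSemiAnbd2006, Thm 3.7(iii) p.41] -/
theorem exists_fixed_height_le_rayGen (H : 𝒢.graph.Vertex → ℕ) (hH : ∀ k, k ≤ H (v (k + 1))) (k j : ℕ)
    (x : 𝒢.Ge (𝒢.graph.edgeOf (βp k))) :
    ∃ y : (D.tree j).Vertex, k ≤ H ((D.treeProj j).vertexMap y) ∧
      (D.treeAct h𝒢 j ((rayPointSeq ham hap hmp P₀ (k + 1)).decompHom
        (𝒢.brHom (βp k) (v (k + 1)) (hap k) x))).hom.vertexMap y = y := by
  obtain ⟨y, hy, hfix⟩ := exists_fixed_over_succ_rayGen ham hap hmp P₀ k j x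
  exact ⟨y, by rw [hy]; exact hH k, hfix⟩

end Ray

end GaloisLevelData

end ProfiniteSemiGraph

end Literature.AnabelianGeometry.SemiGraphs
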